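import Summits.CriticalPhenomena.SAWScalingLimit.Theorems.SAWDefectDecoherenceBoundaryClosureRGateMassLaws
import HarnessLib

/-!
# Crux `BoundaryClosureR` (stmt-CriticalPhenomena-14004), line `polygon-parity-squeeze`,
# stub `stub_squeeze`: the SANDWICH LEMMAS of the squeeze (mechanism (B))

Landing target:
`Summits/CriticalPhenomena/SAWScalingLimit/Theorems/SAWDefectDecoherenceBoundaryClosureRSqueezeSandwich.lean`
(`--supports stmt-CriticalPhenomena-14004`).

The squeeze (B) of the line compares the `σ = 0` arrival masses
`Z_Λ(a → z) = ‖F_{Λ, a, x_c, 0}(z)‖` of three nested hexagonal-lattice domains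
`Λ'' ⊆ Λ' ⊆ Λ` (`Λ'' =` the collar-deleted domain, `Λ' =` the inner exact polygon, `Λ =` the
admissible family): domain monotonicity (`GateMass.norm_obs_zero_mono`) and collar avoidance
(`(1 - ε) Z_Λ ≤ Z_{Λ''}`) give the two-sided pinch `(1 - ε) Z_Λ ≤ Z_{Λ'} ≤ Z_Λ`
(`squeeze_sandwich`).  The rest of the file is the real/complex arithmetic the limit argument
consumes: the pinch of a ratio `A / B` by pinched numerator and denominator
(`ratio_pinch_lower`, `ratio_pinch_upper`, `abs_ratio_pinch_le`), and the SUMMED forms for finite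
families with complex weights `g_e` — `‖Σ g_e A'_e - Σ g_e A_e‖ ≤ ε Σ ‖g_e‖ A_e`
(`norm_sum_pinch_le`), `Σ ‖g_e‖ A_e ≤ (1 - ε)⁻¹ Σ ‖g_e‖ A'_e` (`sum_pinch_upper`), and the ratio
version `‖Σ g_e (A'_e / B' - A_e / B)‖ ≤ (ε / (1 - ε)) Σ ‖g_e‖ A_e / B`
(`norm_sum_ratio_pinch_le`).  Finally `obs_zero_eq_ofReal_norm`: at spin `0` the observable IS
the real number `Z` (so the complex gate sums of `GateProfileAt` are sums of `g_e · Z_e`).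

Sources: H. Duminil-Copin, S. Smirnov, Ann. of Math. 175 (2012), Def. 1 (`σ = 0`);
G. Lawler, O. Schramm, W. Werner, *On the scaling limit of planar self-avoiding walk* (2004),
§3.4 (restriction).  Everything here is proved; no definition, no named fact.
-/

noncomputable section

open scoped BigOperators
open Literature.Probability.LatticeModels (HexVertex)
open Literature.Probability.RandomPlanarGeometry
open Literature.Probability.RandomPlanarGeometry.SAW
open Summit.CriticalPhenomena.SAWScalingLimit.Theorems.ObservableToSLE.FloorRatio (archMass_nonneg)
open Summit.CriticalPhenomena.SAWScalingLimit.Theorems.PickHalfPlane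

namespace Summit.CriticalPhenomena.SAWScalingLimit.Theorems.PolygonParitySqueeze

/-! ### 1. The `σ = 0` observable is its own mass -/

/-- **At spin `0` the observable is the real number `Z_Λ(a → z)`**:
`F_{Λ, a, x_c, 0}(z) = ↑‖F_{Λ, a, x_c, 0}(z)‖` (it is the nonnegative generating function of the
walks). [cite: DuminilCopinSmirnov2012, Def. 1] -/
theorem obs_zero_eq_ofReal_norm (Λ : Finset HexVertex) (a z : Sym2 HexVertex) :
    hexParafermionicObservable Λ a hexCriticalFugacity 0 z =
      ((‖hexParafermionicObservable Λ a hexCriticalFugacity 0 z‖ : ℝ) : ℂ) := by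
  rw [GateMass.norm_obs_zero_eq_archMass, hexParafermionicObservable_zero_spin]

/-- The quotient of two `σ = 0` observables is the real quotient of the masses.
[cite: DuminilCopinSmirnov2012, Def. 1] -/
theorem obs_zero_div_eq_ofReal (Λ : Finset HexVertex) (a z b : Sym2 HexVertex) :
    hexParafermionicObservable Λ a hexCriticalFugacity 0 z /
        hexParafermionicObservable Λ a hexCriticalFugacity 0 b =
      ((‖hexParafermionicObservable Λ a hexCriticalFugacity 0 z‖ /
          ‖hexParafermionicObservable Λ a hexCriticalFugacity 0 b‖ : ℝ) : ℂ) := by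
  rw [obs_zero_eq_ofReal_norm Λ a z, obs_zero_eq_ofReal_norm Λ a b, Complex.ofReal_div]
  simp only [Complex.norm_real, Real.norm_eq_abs, abs_norm]

/-! ### 2. The lattice sandwich -/

/-- **The squeeze sandwich.** For nested domains `Λ'' ⊆ Λ' ⊆ Λ`, if deleting down to `Λ''` keeps
at least `(1 - ε)` of the `σ = 0` mass `Z_Λ(a → z)`, then the intermediate domain is pinched:
`(1 - ε) Z_Λ(a → z) ≤ Z_{Λ'}(a → z) ≤ Z_Λ(a → z)` (domain monotonicity twice).
[cite: LawlerSchrammWerner2004SAW, §3.4 ("SAW satisfies restriction")] -/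
theorem squeeze_sandwich : ∀ (Λ Λ' Λ'' : Finset HexVertex) (a z : Sym2 HexVertex) (ε : ℝ), Λ'' ⊆ Λ' → Λ' ⊆ Λ → (1 - ε) * ‖hexParafermionicObservable Λ a hexCriticalFugacity 0 z‖ ≤ ‖hexParafermionicObservable Λ'' a hexCriticalFugacity 0 z‖ → (1 - ε) * ‖hexParafermionicObservable Λ a hexCriticalFugacity 0 z‖ ≤ ‖hexParafermionicObservable Λ' a hexCriticalFugacity 0 z‖ ∧ ‖hexParafermionicObservable Λ' a hexCriticalFugacity 0 z‖ ≤ ‖hexParafermionicObservable Λ a hexCriticalFugacity 0 z‖ :=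
  fun _ _ _ a z _ h'' h' hε =>
    ⟨hε.trans (GateMass.norm_obs_zero_mono h'' a z), GateMass.norm_obs_zero_mono h' a z⟩

/-! ### 3. Pinched ratios -/

/-- Lower ratio pinch: `(1 - ε) A ≤ A'`, `0 < B' ≤ B`, `0 ≤ A`, `ε ≤ 1` give
`(1 - ε) (A / B) ≤ A' / B'`. [folklore] -/
theorem ratio_pinch_lower {ε A A' B B' : ℝ} (hε : ε ≤ 1) (hA : 0 ≤ A) (hA' : (1 - ε) * A ≤ A')
    (hB' : 0 < B') (hBB' : B' ≤ B) : (1 - ε) * (A / B) ≤ A' / B' := by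
  have hB : 0 < B := lt_of_lt_of_le hB' hBB'
  calc (1 - ε) * (A / B) = (1 - ε) * A / B := by ring
    _ ≤ (1 - ε) * A / B' := by
        apply div_le_div_of_nonneg_left _ hB' hBB'
        exact mul_nonneg (by linarith) hA
    _ ≤ A' / B' := div_le_div_of_nonneg_right hA' hB'.le

/-- Upper ratio pinch: `A' ≤ A`, `(1 - ε) B ≤ B'`, `0 < B`, `0 ≤ A`, `ε < 1` give
`A' / B' ≤ (A / B) / (1 - ε)`. [folklore] -/
theorem ratio_pinch_upper {ε A A' B B' : ℝ} (hε : ε < 1) (hA : 0 ≤ A) (hA' : A' ≤ A)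
    (hB : 0 < B) (hBB' : (1 - ε) * B ≤ B') : A' / B' ≤ A / B / (1 - ε) := by
  have h1 : 0 < 1 - ε := by linarith
  have hB'pos : 0 < B' := lt_of_lt_of_le (mul_pos h1 hB) hBB'
  calc A' / B' ≤ A / B' := div_le_div_of_nonneg_right hA' hB'pos.le
    _ ≤ A / ((1 - ε) * B) := div_le_div_of_nonneg_left hA (mul_pos h1 hB) hBB'
    _ = A / B / (1 - ε) := by rw [mul_comm, div_div]

/-- **Two-sided ratio pinch**: with `0 ≤ ε < 1`, `0 ≤ A`, `0 < B`, `(1 - ε) A ≤ A' ≤ A` and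
`(1 - ε) B ≤ B' ≤ B`, `|A' / B' - A / B| ≤ (ε / (1 - ε)) (A / B)`. [folklore] -/
theorem abs_ratio_pinch_le {ε A A' B B' : ℝ} (hε₀ : 0 ≤ ε) (hε : ε < 1) (hA : 0 ≤ A) (hB : 0 < B)
    (hA₁ : (1 - ε) * A ≤ A') (hA₂ : A' ≤ A) (hB₁ : (1 - ε) * B ≤ B') (hB₂ : B' ≤ B) :
    |A' / B' - A / B| ≤ ε / (1 - ε) * (A / B) := by
  have h1 : 0 < 1 - ε := by linarith
  have hB'pos : 0 < B' := lt_of_lt_of_le (mul_pos h1 hB) hB₁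
  have hAB : 0 ≤ A / B := div_nonneg hA hB.le
  have hup : A' / B' ≤ A / B / (1 - ε) := ratio_pinch_upper hε hA hA₂ hB hB₁
  have hlo : (1 - ε) * (A / B) ≤ A' / B' := ratio_pinch_lower hε.le hA hA₁ hB'pos hB₂
  have hkey : A / B / (1 - ε) - A / B = ε / (1 - ε) * (A / B) := by
    field_simp
    ring
  rw [abs_le]
  constructor
  · -- `A/B - A'/B' ≤ ε A/B ≤ (ε/(1-ε)) A/B`
    have h2 : ε * (A / B) ≤ ε / (1 - ε) * (A / B) := by
      apply mul_le_mul_of_nonneg_right _ hAB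
      rw [le_div_iff₀ h1]
      nlinarith
    nlinarith
  · linarith

/-! ### 4. Summed forms (finite families, complex weights) -/

/-- **Summed pinch.** For a finite family with complex weights `g_i` and pinched nonnegative
masses `(1 - ε) A_i ≤ A'_i ≤ A_i`:  `‖Σ g_i A'_i - Σ g_i A_i‖ ≤ ε Σ ‖g_i‖ A_i`. [folklore] -/
theorem norm_sum_pinch_le {ι : Type*} (s : Finset ι) (g : ι → ℂ) (A A' : ι → ℝ) {ε : ℝ}
    (h : ∀ i ∈ s, (1 - ε) * A i ≤ A' i ∧ A' i ≤ A i) :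
    ‖∑ i ∈ s, g i * (A' i : ℂ) - ∑ i ∈ s, g i * (A i : ℂ)‖ ≤ ε * ∑ i ∈ s, ‖g i‖ * A i := by
  rw [← Finset.sum_sub_distrib, Finset.mul_sum]
  refine (norm_sum_le _ _).trans (Finset.sum_le_sum fun i hi => ?_)
  obtain ⟨h1, h2⟩ := h i hi
  rw [← mul_sub, norm_mul, ← Complex.ofReal_sub, Complex.norm_real, Real.norm_eq_abs,
    abs_of_nonpos (by linarith), mul_left_comm]
  exact mul_le_mul_of_nonneg_left (by linarith) (norm_nonneg _)

/-- **Upper transfer of a positive sum**: `(1 - ε) A_i ≤ A'_i` for all `i` and `ε < 1` give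
`Σ ‖g_i‖ A_i ≤ (1 - ε)⁻¹ Σ ‖g_i‖ A'_i`. [folklore] -/
theorem sum_pinch_upper {ι : Type*} (s : Finset ι) (g : ι → ℂ) (A A' : ι → ℝ) {ε : ℝ}
    (hε : ε < 1) (h : ∀ i ∈ s, (1 - ε) * A i ≤ A' i) :
    ∑ i ∈ s, ‖g i‖ * A i ≤ (1 - ε)⁻¹ * ∑ i ∈ s, ‖g i‖ * A' i := by
  have h1 : 0 < 1 - ε := by linarith
  rw [Finset.mul_sum]
  refine Finset.sum_le_sum fun i hi => ?_
  have hA : A i ≤ (1 - ε)⁻¹ * A' i := by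
    rw [le_inv_mul_iff₀ h1]
    exact h i hi
  calc ‖g i‖ * A i ≤ ‖g i‖ * ((1 - ε)⁻¹ * A' i) := mul_le_mul_of_nonneg_left hA (norm_nonneg _)
    _ = (1 - ε)⁻¹ * (‖g i‖ * A' i) := by ring

/-- **Summed ratio pinch.** For a finite family with complex weights `g_i`, nonnegative masses
pinched as `(1 - ε) A_i ≤ A'_i ≤ A_i`, and normalisers `0 < B`, `(1 - ε) B ≤ B' ≤ B`
(`0 ≤ ε < 1`):  `‖Σ g_i (A'_i / B') - Σ g_i (A_i / B)‖ ≤ (ε / (1 - ε)) Σ ‖g_i‖ (A_i / B)`.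
[folklore] -/
theorem norm_sum_ratio_pinch_le {ι : Type*} (s : Finset ι) (g : ι → ℂ) (A A' : ι → ℝ)
    {ε B B' : ℝ} (hε₀ : 0 ≤ ε) (hε : ε < 1) (hB : 0 < B) (hB₁ : (1 - ε) * B ≤ B') (hB₂ : B' ≤ B)
    (hA : ∀ i ∈ s, 0 ≤ A i ∧ (1 - ε) * A i ≤ A' i ∧ A' i ≤ A i) :
    ‖∑ i ∈ s, g i * ((A' i / B' : ℝ) : ℂ) - ∑ i ∈ s, g i * ((A i / B : ℝ) : ℂ)‖ ≤
      ε / (1 - ε) * ∑ i ∈ s, ‖g i‖ * (A i / B) := by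
  rw [← Finset.sum_sub_distrib, Finset.mul_sum]
  refine (norm_sum_le _ _).trans (Finset.sum_le_sum fun i hi => ?_)
  obtain ⟨h0, h1, h2⟩ := hA i hi
  rw [← mul_sub, norm_mul, ← Complex.ofReal_sub, Complex.norm_real, Real.norm_eq_abs, mul_left_comm]
  exact mul_le_mul_of_nonneg_left (abs_ratio_pinch_le hε₀ hε h0 hB h1 h2 hB₁ hB₂) (norm_nonneg _)

end Summit.CriticalPhenomena.SAWScalingLimit.Theorems.PolygonParitySqueeze

end
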